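import Literature.Analysis.FluidPDE.BourgainPavlovicResonance
import Mathlib.Analysis.Complex.ExponentialBounds
import Mathlib.Analysis.Real.Pi.Bounds
import HarnessLib

/-!
# The inflating low mode of the Bourgain–Pavlović second iterate

Seventh support file for the discharge of the barrier
`Literature.Barriers.NavierStokesRegularity.CriticalBesovNormInflation` (Bourgain–Pavlović 2008,
Thm. 1.1): the quantitative heart of the construction, Bourgain–Pavlović's (3.6)–(3.8) and
(3.22)–(3.24). Near the low mode `η = e₀` the second iterate `u₁(T)` of the datum is
`2πi ×` a real, **sign-definite** quantity of size `≳ α² r = Q²`, uniformly in the lacunary scales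
(`BourgainPavlovicResonance` isolated the two resonant ordered pairs `(k_s, −k'_s)`,
`(−k'_s, k_s)` of each scale `s < r`). Precisely, with `m = ∫ψ` and the bump autocorrelation
`(ψ⋆ψ)`:

* `bumpConv = ψ ⋆ ψ` (nonnegative, `≤ m`, vanishing off `B(0, 2ρ)`, continuous, `∫ ψ⋆ψ = m²`);
* the **resonant kernels in coordinates**: for `‖ξ − η‖ < 2ρ` and `ρ ≤ 1/100`, the pair
  `(k_s, −k'_s)` (`p`-polarised times `q`-polarised) has contraction `≤ −0.96 N_s²` on the support
  (the factor `(ξ·p(η'))(q₂(ξ−η') − …) ≈ N_s · (−N_s)`), whence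
  `−pairG ≥ 0.96 α² N_s² e^{-8π²(N_s+2)² r⁺} (ψ⋆ψ)(ξ−η)`; the reversed pair `(−k'_s, k_s)` has
  `p₂ ≡ 0` and only the Leray correction survives, `|pairG| ≤ 0.0005 α² N_s² e^{-4π² N_s² r⁺} (ψ⋆ψ)(ξ−η)`
  (this is where the polarisations `p ∥ e₀` at `k_s`, `q ∥ e₂` at `k'_s` replace BP's (3.3));
* the **time integrals** (BP (3.8): `N_s² ∫₀ᵀ e^{-c N_s² τ} dτ ∼ 1` once `N_0² T ≳ 1`): for
  `0 < T ≤ 1/400` and `8π² N_0² T ≥ 1`,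
  `−(pairGT (k_s,−k'_s) + pairGT (−k'_s,k_s)) ≥ α² (ψ⋆ψ)(ξ−η) / 250` for every scale, and summing
  the `r` scales (**`signal_lower_bound`**):
  `α² r (ψ⋆ψ)(ξ − η) / 250 ≤ −Im u₁(T, ξ)₂ / (2π)`, `Re u₁(T, ξ)₂ = 0`,
  i.e. `−u₁(T,ξ)₂ = 2πi 𝓡(ξ)` with `𝓡 ≥ Q² (ψ⋆ψ)(ξ−η)/250 ≥ 0` on `B(η, 2ρ)` (`α² r = Q²`).

## References

* J. Bourgain, N. Pavlović, J. Funct. Anal. 255 (2008), §3.2, (3.6)–(3.8), (3.22)–(3.24). [BourgainPavlovic2008]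
-/

noncomputable section

open MeasureTheory Real Set Filter Topology Function Complex intervalIntegral
open scoped ComplexConjugate ENNReal NNReal Convolution

namespace Literature.Analysis.FluidPDE.BourgainPavlovic

open FourierNS Literature.Analysis.FunctionSpaces

/-- Local notation for frequency space `ℝ³`. -/
local notation "E3" => EuclideanSpace ℝ (Fin 3)

/-! ### Scalar inequalities -/

namespace SignalScalar

/-- Combo A, first factor: `ξ·p(η') = ξ₀η'₁ − ξ₁η'₀ ≥ 0.97 N`. [folklore] -/
theorem comboA_S1 {N ρ ξ0 ξ1 y0 y1 : ℝ} (hN : 8 ≤ N) (hρ0 : 0 ≤ ρ) (hρ : ρ ≤ 1 / 100)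
    (hξ0 : |ξ0 - 1| ≤ 2 * ρ) (hξ1 : |ξ1| ≤ 2 * ρ) (hy0 : |y0| ≤ ρ) (hy1 : |y1 - N| ≤ ρ) :
    0.97 * N ≤ ξ0 * y1 - ξ1 * y0 := by
  have h1 : 1 - 2 * ρ ≤ ξ0 := by linarith [(abs_le.1 hξ0).1]
  have h2 : N - ρ ≤ y1 := by linarith [(abs_le.1 hy1).1]
  have h3 : (1 - 2 * ρ) * (N - ρ) ≤ ξ0 * y1 := mul_le_mul h1 h2 (by linarith) (by linarith)
  have h4 : |ξ1 * y0| ≤ 2 * ρ * ρ := by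
    rw [abs_mul]; exact mul_le_mul hξ1 hy0 (abs_nonneg _) (by linarith)
  have h5 : ξ1 * y0 ≤ 2 * ρ * ρ := le_trans (le_abs_self _) h4
  nlinarith

/-- Combo A, second factor: `q₂(ζ) − ξ₂ (ξ·q(ζ))/‖ξ‖² ≤ −0.99 N` (`ζ = ξ − η'`). [folklore] -/
theorem comboA_bracket {N ρ ξ1 ξ2 y1 y2 n : ℝ} (hN : 8 ≤ N) (hρ0 : 0 ≤ ρ) (hρ : ρ ≤ 1 / 100)
    (hξ1 : |ξ1| ≤ 2 * ρ) (hξ2 : |ξ2| ≤ 2 * ρ) (hy1 : |y1 - N| ≤ ρ) (hy2 : |y2| ≤ ρ)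
    (hn : 1 - 2 * ρ ≤ n) :
    (ξ1 - y1) - ξ2 * (-(ξ1 * (ξ2 - y2)) + ξ2 * (ξ1 - y1)) / n ^ 2 ≤ -0.99 * N := by
  have hn0 : 0 < n := by linarith
  have hn2 : (0.96 : ℝ) ≤ n ^ 2 := by nlinarith
  set S2 : ℝ := -(ξ1 * (ξ2 - y2)) + ξ2 * (ξ1 - y1) with hS2
  have hζ1 : ξ1 - y1 ≤ -N + 3 * ρ := by linarith [(abs_le.1 hξ1).2, (abs_le.1 hy1).1]
  have hz2 : |ξ2 - y2| ≤ 3 * ρ := by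
    calc |ξ2 - y2| ≤ |ξ2| + |y2| := abs_sub _ _
      _ ≤ 3 * ρ := by linarith
  have hz1 : |ξ1 - y1| ≤ N + 3 * ρ := by
    rw [abs_le]; constructor <;>
      linarith [(abs_le.1 hξ1).1, (abs_le.1 hξ1).2, (abs_le.1 hy1).1, (abs_le.1 hy1).2]
  have hS2abs : |S2| ≤ 2 * ρ * (3 * ρ) + 2 * ρ * (N + 3 * ρ) := by
    calc |S2| ≤ |ξ1 * (ξ2 - y2)| + |ξ2 * (ξ1 - y1)| := by
          rw [hS2]; refine (abs_add_le _ _).trans ?_; rw [abs_neg]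
      _ ≤ 2 * ρ * (3 * ρ) + 2 * ρ * (N + 3 * ρ) := by
          rw [abs_mul, abs_mul]
          exact add_le_add (mul_le_mul hξ1 hz2 (abs_nonneg _) (by linarith))
            (mul_le_mul hξ2 hz1 (abs_nonneg _) (by linarith))
  have hprod : |ξ2 * S2| ≤ 2 * ρ * (2 * ρ * (3 * ρ) + 2 * ρ * (N + 3 * ρ)) := by
    rw [abs_mul]; exact mul_le_mul hξ2 hS2abs (abs_nonneg _) (by linarith)
  have hρ2 : ρ ^ 2 ≤ 1 / 10000 := by nlinarith
  have hρ3 : ρ ^ 3 ≤ 1 / 1000000 := by nlinarith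
  have hnum : 2 * ρ * (2 * ρ * (3 * ρ) + 2 * ρ * (N + 3 * ρ)) ≤ 0.0004 * N + 0.000024 := by
    have : 2 * ρ * (2 * ρ * (3 * ρ) + 2 * ρ * (N + 3 * ρ)) = 4 * ρ ^ 2 * N + 24 * ρ ^ 3 := by ring
    rw [this]
    nlinarith [mul_le_mul_of_nonneg_right hρ2 (by linarith : (0 : ℝ) ≤ N)]
  have hfrac : |ξ2 * S2 / n ^ 2| ≤ 0.0005 * N := by
    rw [abs_div, abs_of_pos (by positivity : (0 : ℝ) < n ^ 2), div_le_iff₀ (by positivity)]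
    nlinarith
  have hfrac' : -(ξ2 * S2 / n ^ 2) ≤ 0.0005 * N := le_trans (neg_le_abs _) hfrac
  linarith

/-- **Combo A contraction**: `−(ξ·p(η')) (q₂(ζ) − ξ₂(ξ·q(ζ))/‖ξ‖²) ≥ 0.96 N²` in the
coordinates `|ξ₀−1|, |ξ₁|, |ξ₂| ≤ 2ρ`, `|η'₀|, |η'₁−N|, |η'₂| ≤ ρ`, `‖ξ‖ ≥ 1−2ρ`, `ρ ≤ 1/100`. [folklore] -/
theorem comboA_contr {N ρ ξ0 ξ1 ξ2 y0 y1 y2 n : ℝ} (hN : 8 ≤ N) (hρ0 : 0 ≤ ρ) (hρ : ρ ≤ 1 / 100)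
    (hξ0 : |ξ0 - 1| ≤ 2 * ρ) (hξ1 : |ξ1| ≤ 2 * ρ) (hξ2 : |ξ2| ≤ 2 * ρ) (hy0 : |y0| ≤ ρ)
    (hy1 : |y1 - N| ≤ ρ) (hy2 : |y2| ≤ ρ) (hn : 1 - 2 * ρ ≤ n) :
    0.96 * N ^ 2 ≤ -((ξ0 * y1 - ξ1 * y0) *
      ((ξ1 - y1) - ξ2 * (-(ξ1 * (ξ2 - y2)) + ξ2 * (ξ1 - y1)) / n ^ 2)) := by
  have h1 := comboA_S1 hN hρ0 hρ hξ0 hξ1 hy0 hy1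
  have h2 := comboA_bracket hN hρ0 hρ hξ1 hξ2 hy1 hy2 hn
  set S1 := ξ0 * y1 - ξ1 * y0
  set B := (ξ1 - y1) - ξ2 * (-(ξ1 * (ξ2 - y2)) + ξ2 * (ξ1 - y1)) / n ^ 2
  have hS1 : 0 ≤ S1 := by nlinarith
  have : S1 * (-B) ≥ (0.97 * N) * (0.99 * N) := mul_le_mul h1 (by linarith) (by positivity) hS1
  nlinarith

/-- **Combo B contraction**: with `η'` near `−k'_s` (`|η'₀−1|, |η'₁+N|, |η'₂| ≤ ρ`) and
`p₂ ≡ 0`, `|(ξ·q(η')) (0 − ξ₂(ξ·p(ζ))/‖ξ‖²)| ≤ 0.0005 N²`. [folklore] -/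
theorem comboB_contr {N ρ ξ0 ξ1 ξ2 y0 y1 y2 n : ℝ} (hN : 8 ≤ N) (hρ0 : 0 ≤ ρ) (hρ : ρ ≤ 1 / 100)
    (hξ0 : |ξ0 - 1| ≤ 2 * ρ) (hξ1 : |ξ1| ≤ 2 * ρ) (hξ2 : |ξ2| ≤ 2 * ρ) (hy0 : |y0 - 1| ≤ ρ)
    (hy1 : |y1 + N| ≤ ρ) (hy2 : |y2| ≤ ρ) (hn : 1 - 2 * ρ ≤ n) :
    |(-(ξ1 * y2) + ξ2 * y1) * (0 - ξ2 * (ξ0 * (ξ1 - y1) - ξ1 * (ξ0 - y0)) / n ^ 2)| ≤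
      0.0005 * N ^ 2 := by
  have hn0 : 0 < n := by linarith
  have hn2 : (0.96 : ℝ) ≤ n ^ 2 := by nlinarith
  set S1 : ℝ := -(ξ1 * y2) + ξ2 * y1 with hS1
  set S2 : ℝ := ξ0 * (ξ1 - y1) - ξ1 * (ξ0 - y0) with hS2
  have hS1abs : |S1| ≤ 2 * ρ * ρ + 2 * ρ * (N + ρ) := by
    have h1 : |y1| ≤ N + ρ := by
      rw [abs_le]; constructor <;> linarith [(abs_le.1 hy1).1, (abs_le.1 hy1).2]
    calc |S1| ≤ |ξ1 * y2| + |ξ2 * y1| := by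
          rw [hS1]; refine (abs_add_le _ _).trans ?_; rw [abs_neg]
      _ ≤ 2 * ρ * ρ + 2 * ρ * (N + ρ) := by
          rw [abs_mul, abs_mul]
          exact add_le_add (mul_le_mul hξ1 hy2 (abs_nonneg _) (by linarith))
            (mul_le_mul hξ2 h1 (abs_nonneg _) (by linarith))
  have hS2abs : |S2| ≤ (1 + 2 * ρ) * (N + 3 * ρ) + 2 * ρ * (3 * ρ) := by
    have h0 : |ξ0| ≤ 1 + 2 * ρ := by
      calc |ξ0| = |(ξ0 - 1) + 1| := by ring_nf
        _ ≤ |ξ0 - 1| + |1| := abs_add_le _ _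
        _ ≤ 1 + 2 * ρ := by rw [abs_one]; linarith
    have h1 : |ξ1 - y1| ≤ N + 3 * ρ := by
      rw [abs_le]; constructor <;>
        linarith [(abs_le.1 hξ1).1, (abs_le.1 hξ1).2, (abs_le.1 hy1).1, (abs_le.1 hy1).2]
    have h2 : |ξ0 - y0| ≤ 3 * ρ := by
      rw [abs_le]; constructor <;>
        linarith [(abs_le.1 hξ0).1, (abs_le.1 hξ0).2, (abs_le.1 hy0).1, (abs_le.1 hy0).2]
    calc |S2| ≤ |ξ0 * (ξ1 - y1)| + |ξ1 * (ξ0 - y0)| := by rw [hS2]; exact abs_sub _ _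
      _ ≤ (1 + 2 * ρ) * (N + 3 * ρ) + 2 * ρ * (3 * ρ) := by
          rw [abs_mul, abs_mul]
          exact add_le_add (mul_le_mul h0 h1 (abs_nonneg _) (by linarith))
            (mul_le_mul hξ1 h2 (abs_nonneg _) (by linarith))
  have hρ2 : ρ ^ 2 ≤ 1 / 10000 := by nlinarith
  have hNρ : ρ * N ≤ N / 100 := by nlinarith
  have hS1' : |S1| ≤ 0.02 * N + 0.0004 := by
    have : 2 * ρ * ρ + 2 * ρ * (N + ρ) = 4 * ρ ^ 2 + 2 * (ρ * N) := by ring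
    rw [this] at hS1abs; nlinarith
  have hS2' : |S2| ≤ 1.02 * N + 0.032 := by
    have : (1 + 2 * ρ) * (N + 3 * ρ) + 2 * ρ * (3 * ρ) = N + 3 * ρ + 2 * (ρ * N) + 12 * ρ ^ 2 := by
      ring
    rw [this] at hS2abs; nlinarith
  have hfrac : |ξ2 * S2 / n ^ 2| ≤ 0.0214 * N := by
    rw [abs_div, abs_of_pos (by positivity : (0 : ℝ) < n ^ 2), div_le_iff₀ (by positivity), abs_mul]
    have : |ξ2| * |S2| ≤ 2 * ρ * (1.02 * N + 0.032) :=
      mul_le_mul hξ2 hS2' (abs_nonneg _) (by linarith)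
    nlinarith
  rw [zero_sub, mul_neg, abs_neg, abs_mul]
  have hN0 : (0 : ℝ) ≤ N := by linarith
  calc |S1| * |ξ2 * S2 / n ^ 2| ≤ (0.02 * N + 0.0004) * (0.0214 * N) :=
        mul_le_mul hS1' hfrac (abs_nonneg _) (by positivity)
    _ ≤ 0.0005 * N ^ 2 := by nlinarith

/-- `∫₀ᵀ e^{-κ r} dr = (1 − e^{-κT})/κ`. [folklore] -/
theorem integral_exp_neg_eq {κ : ℝ} (hκ : 0 < κ) (T : ℝ) :
    ∫ r in (0 : ℝ)..T, Real.exp (-κ * r) = (1 - Real.exp (-κ * T)) / κ := by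
  have hderiv : ∀ r ∈ Set.uIcc (0 : ℝ) T,
      HasDerivAt (fun r => -Real.exp (-κ * r) / κ) (Real.exp (-κ * r)) r := by
    intro r _
    have h1 : HasDerivAt (fun r => -κ * r) (-κ) r := by simpa using (hasDerivAt_id r).const_mul (-κ)
    have h2 := (h1.exp.neg).div_const κ
    have h3 : -(Real.exp (-κ * r) * -κ) / κ = Real.exp (-κ * r) := by field_simp
    rw [h3] at h2
    exact h2
  have hcont : Continuous fun r => Real.exp (-κ * r) := by fun_prop
  rw [intervalIntegral.integral_eq_sub_of_hasDerivAt hderiv (hcont.intervalIntegrable _ _)]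
  simp only [mul_zero, Real.exp_zero]
  field_simp
  ring

/-- `∫₀ᵀ e^{-κ r} dr ≥ 0.632/κ` once `κ T ≥ 1` (`1 − e^{-1} > 0.632`). [folklore] -/
theorem integral_exp_neg_ge {κ T : ℝ} (hκ : 0 < κ) (hκT : 1 ≤ κ * T) :
    0.632 / κ ≤ ∫ r in (0 : ℝ)..T, Real.exp (-κ * r) := by
  rw [integral_exp_neg_eq hκ]
  have h1 : Real.exp (-κ * T) ≤ Real.exp (-1) := Real.exp_le_exp.2 (by linarith)
  have h2 := Real.exp_neg_one_lt_d9
  refine div_le_div_of_nonneg_right ?_ hκ.le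
  rw [neg_mul] at h1
  norm_num at h2 ⊢
  linarith

/-- `∫₀ᵀ e^{-κ r} dr ≤ 1/κ`. [folklore] -/
theorem integral_exp_neg_le {κ : ℝ} (hκ : 0 < κ) (T : ℝ) :
    ∫ r in (0 : ℝ)..T, Real.exp (-κ * r) ≤ 1 / κ := by
  rw [integral_exp_neg_eq hκ]
  exact div_le_div_of_nonneg_right (by linarith [Real.exp_pos (-κ * T)]) hκ.le

/-- The heat loss at the low mode over the short time `T ≤ 1/400`: `e^{-1.05·4π²·T} ≥ 0.89`. [folklore] -/
theorem exp_neg_ge_089 {T : ℝ} (hT : T ≤ 1 / 400) (hT0 : 0 ≤ T) :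
    0.89 ≤ Real.exp (-(1.05 * (4 * π ^ 2) * T)) := by
  have h := Real.add_one_le_exp (-(1.05 * (4 * π ^ 2) * T))
  have hπ := Real.pi_lt_d2
  have hπ0 := Real.pi_pos
  have hc : 4 * π ^ 2 ≤ 39.69 := by nlinarith
  have : 1.05 * (4 * π ^ 2) * T ≤ 1.05 * 39.69 * (1 / 400) :=
    mul_le_mul (mul_le_mul_of_nonneg_left hc (by norm_num)) hT hT0 (by positivity)
  norm_num at this ⊢
  linarith

/-- `4π² ≤ 39.69`. [folklore] -/
theorem four_pi_sq_le : 4 * π ^ 2 ≤ 39.69 := by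
  have hπ := Real.pi_lt_d2
  have hπ0 := Real.pi_pos
  nlinarith

end SignalScalar

namespace InflationParams

variable (d : InflationParams)

/-! ### The bump autocorrelation -/

/-- **The bump autocorrelation** `(ψ ⋆ ψ)(z) = ∫ ψ(t) ψ(z − t) dt`. [folklore] -/
def bumpConv : E3 → ℝ := d.ψ ⋆[ContinuousLinearMap.mul ℝ ℝ, volume] d.ψ

/-- Unfolding the autocorrelation. [folklore] -/
theorem bumpConv_apply (z : E3) : d.bumpConv z = ∫ t, d.ψ t * d.ψ (z - t) := by
  simp [bumpConv, convolution_def]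

/-- `ψ` has compact support. [folklore] -/
theorem hasCompactSupport_ψ : HasCompactSupport d.ψ := d.bump.hasCompactSupport

/-- `ψ ⋆ ψ ≥ 0`. [folklore] -/
theorem bumpConv_nonneg (z : E3) : 0 ≤ d.bumpConv z := by
  rw [bumpConv_apply]
  exact integral_nonneg fun t => mul_nonneg (d.ψ_nonneg _) (d.ψ_nonneg _)

/-- `(ψ ⋆ ψ)(z) ≤ m`. [folklore] -/
theorem bumpConv_le (z : E3) : d.bumpConv z ≤ d.bumpMass := by
  rw [bumpConv_apply, bumpMass]
  refine integral_mono_of_nonneg (Eventually.of_forall fun t => mul_nonneg (d.ψ_nonneg _) (d.ψ_nonneg _))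
    d.integrable_ψ (Eventually.of_forall fun t => ?_)
  calc d.ψ t * d.ψ (z - t) ≤ d.ψ t * 1 := mul_le_mul_of_nonneg_left (d.ψ_le_one _) (d.ψ_nonneg _)
    _ = d.ψ t := mul_one _

/-- `∫ ψ ⋆ ψ = m²`. [folklore] -/
theorem integral_bumpConv : ∫ z, d.bumpConv z = d.bumpMass ^ 2 := by
  rw [bumpConv, integral_convolution (L := ContinuousLinearMap.mul ℝ ℝ) d.integrable_ψ d.integrable_ψ,
    ContinuousLinearMap.mul_apply', bumpMass, sq]

/-- `ψ ⋆ ψ` is continuous. [folklore] -/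
theorem continuous_bumpConv : Continuous d.bumpConv :=
  d.hasCompactSupport_ψ.continuous_convolution_right _ d.continuous_ψ.locallyIntegrable d.continuous_ψ

/-- `ψ ⋆ ψ` vanishes off `B(0, 2ρ)`. [folklore] -/
theorem bumpConv_eq_zero {z : E3} (h : 2 * d.ρ ≤ ‖z‖) : d.bumpConv z = 0 := by
  rw [bumpConv_apply]
  refine integral_eq_zero_of_ae (Eventually.of_forall fun t => ?_)
  simp only [Pi.zero_apply, mul_eq_zero]
  by_contra hne
  push Not at hne
  have h1 := d.norm_lt_of_ψ_ne_zero hne.1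
  have h2 := d.norm_lt_of_ψ_ne_zero hne.2
  have : ‖z‖ < 2 * d.ρ := by
    calc ‖z‖ = ‖t + (z - t)‖ := by congr 1; abel
      _ ≤ ‖t‖ + ‖z - t‖ := norm_add_le _ _
      _ < d.ρ + d.ρ := add_lt_add h1 h2
      _ = 2 * d.ρ := by ring
  linarith

/-- `ψ ⋆ ψ` is integrable. [folklore] -/
theorem integrable_bumpConv : Integrable d.bumpConv :=
  d.integrable_ψ.integrable_convolution _ d.integrable_ψ

/-- The shifted bump products are integrable. [folklore] -/
theorem integrable_bumpShift (u v ξ : E3) : Integrable fun t : E3 => d.ψ (t - u) * d.ψ (ξ - t - v) := by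
  have hc : Continuous fun t : E3 => d.ψ (t - u) * d.ψ (ξ - t - v) :=
    (d.continuous_ψ.comp (continuous_id.sub continuous_const)).mul
      (d.continuous_ψ.comp ((continuous_const.sub continuous_id).sub continuous_const))
  refine hc.integrable_of_hasCompactSupport ?_
  refine HasCompactSupport.intro (isCompact_closedBall u d.ρ) fun t ht => ?_
  rw [Metric.mem_closedBall, dist_eq_norm, not_le] at ht
  simp [d.ψ_eq_zero ht.le]

/-- **Shifted bump products integrate to the autocorrelation**:
`∫ ψ(t − u) ψ(ξ − t − v) dt = (ψ ⋆ ψ)(ξ − u − v)`. [folklore] -/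
theorem integral_bumpShift (u v ξ : E3) :
    ∫ t, d.ψ (t - u) * d.ψ (ξ - t - v) = d.bumpConv (ξ - u - v) := by
  rw [bumpConv_apply]
  have h := integral_sub_right_eq_self (μ := (volume : Measure E3))
    (fun t => d.ψ t * d.ψ (ξ - u - v - t)) u
  rw [← h]
  refine integral_congr_ae (Eventually.of_forall fun t => ?_)
  simp only
  congr 2
  abel

/-! ### Coordinates near the low mode and near the centres -/

/-- Coordinates of a frequency `ξ` with `‖ξ − η‖ < 2ρ`:
`|ξ₀ − 1|, |ξ₁|, |ξ₂| ≤ 2ρ` and `1 − 2ρ ≤ ‖ξ‖ ≤ 1 + 2ρ`. [folklore] -/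
theorem coords_near_η {ξ : E3} (hξ : ‖ξ - η‖ < 2 * d.ρ) :
    |ξ 0 - 1| ≤ 2 * d.ρ ∧ |ξ 1| ≤ 2 * d.ρ ∧ |ξ 2| ≤ 2 * d.ρ ∧ 1 - 2 * d.ρ ≤ ‖ξ‖ ∧ ‖ξ‖ ≤ 1 + 2 * d.ρ := by
  have hc : ∀ j, |(ξ - η) j| ≤ ‖ξ - η‖ := fun j => abs_apply_le_norm _ j
  have h0 := hc 0; have h1 := hc 1; have h2 := hc 2
  simp only [PiLp.sub_apply, η_apply] at h0 h1 h2
  simp only [Fin.isValue, ↓reduceIte, Fin.one_eq_zero_iff, OfNat.ofNat_ne_one, sub_zero,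
    Fin.reduceEq] at h0 h1 h2
  refine ⟨by linarith, by linarith, by linarith, ?_, ?_⟩
  · have := norm_sub_norm_le (η : E3) ξ
    rw [norm_η, norm_sub_rev] at this
    linarith
  · have := norm_le_norm_add_norm_sub' ξ (η : E3)
    have h' : ‖ξ‖ - ‖(η : E3)‖ ≤ ‖ξ - η‖ := norm_sub_norm_le _ _
    rw [norm_η] at h'
    linarith

/-- Coordinates of `η'` with `‖η' − k_s‖ < ρ`: `|η'₀|, |η'₁ − N_s|, |η'₂| ≤ ρ`. [folklore] -/
theorem coords_near_kvec {s : ℕ} {η' : E3} (h : ‖η' - d.kvec s‖ < d.ρ) :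
    |η' 0| ≤ d.ρ ∧ |η' 1 - d.N s| ≤ d.ρ ∧ |η' 2| ≤ d.ρ := by
  have hc : ∀ j, |(η' - d.kvec s) j| ≤ ‖η' - d.kvec s‖ := fun j => abs_apply_le_norm _ j
  have h0 := hc 0; have h1 := hc 1; have h2 := hc 2
  simp only [PiLp.sub_apply, kvec_apply] at h0 h1 h2
  simp only [Fin.isValue, zero_ne_one, ↓reduceIte, sub_zero, Fin.reduceEq] at h0 h1 h2
  exact ⟨by linarith, by linarith, by linarith⟩

/-- Coordinates of `η'` with `‖η' − (−k'_s)‖ < ρ`: `|η'₀ − 1|, |η'₁ + N_s|, |η'₂| ≤ ρ`. [folklore] -/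
theorem coords_near_neg_kvec' {s : ℕ} {η' : E3} (h : ‖η' - (-d.kvec' s)‖ < d.ρ) :
    |η' 0 - 1| ≤ d.ρ ∧ |η' 1 + d.N s| ≤ d.ρ ∧ |η' 2| ≤ d.ρ := by
  have h' : ‖η' + d.kvec' s‖ < d.ρ := by simpa [sub_neg_eq_add] using h
  have hc : ∀ j, |(η' + d.kvec' s) j| ≤ ‖η' + d.kvec' s‖ := fun j => abs_apply_le_norm _ j
  have h0 := hc 0; have h1 := hc 1; have h2 := hc 2
  simp only [PiLp.add_apply, kvec'_apply] at h0 h1 h2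
  simp only [Fin.isValue, zero_ne_one, ↓reduceIte, zero_sub, one_ne_zero, sub_zero, Fin.reduceEq,
    add_zero] at h0 h1 h2
  refine ⟨?_, by linarith, by linarith⟩
  rw [sub_eq_add_neg]
  linarith

/-! ### The resonant kernels -/

/-- `pol false = p`. [folklore] -/
theorem pol_false : pol false = polP := by
  funext ξ j; rfl

/-- `pol true = q`. [folklore] -/
theorem pol_true : pol true = polQ := by
  funext ξ j; rfl

/-- The contraction of two real pieces factors through the polarisations:
`contr_l(ξ; pieceR a η', pieceR b ζ) = α² ψ(η' − c_a) ψ(ζ − c_b) contr_l(ξ; pol_a η', pol_b ζ)`. [folklore] -/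
theorem contr_pieceR (l : Fin 3) (ξ : E3) (a b : ℕ × Bool × Bool) (η' ζ : E3) :
    contr l ξ (d.pieceR a η') (d.pieceR b ζ) =
      d.α ^ 2 * (d.ψ (η' - d.center a) * d.ψ (ζ - d.center b)) * contr l ξ (pol a.2.2 η') (pol b.2.2 ζ) := by
  simp only [contr, pieceR, Finset.mul_sum]
  refine Finset.sum_congr rfl fun j _ => Finset.sum_congr rfl fun k _ => ?_
  ring

/-- The combo-A contraction in coordinates. [folklore] -/
theorem contr_polP_polQ (ξ η' : E3) :
    contr 2 ξ (polP η') (polQ (ξ - η')) = (ξ 0 * η' 1 - ξ 1 * η' 0) *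
      ((ξ 1 - η' 1) - ξ 2 * (-(ξ 1 * (ξ 2 - η' 2)) + ξ 2 * (ξ 1 - η' 1)) / ‖ξ‖ ^ 2) := by
  rw [contr_eq]
  simp only [Fin.sum_univ_three, polP, polQ, Fin.isValue, Matrix.cons_val_zero, Matrix.cons_val_one,
    Matrix.cons_val, PiLp.sub_apply]
  ring

/-- The combo-B contraction in coordinates (`p₂ ≡ 0`). [folklore] -/
theorem contr_polQ_polP (ξ η' : E3) :
    contr 2 ξ (polQ η') (polP (ξ - η')) = (-(ξ 1 * η' 2) + ξ 2 * η' 1) *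
      (0 - ξ 2 * (ξ 0 * (ξ 1 - η' 1) - ξ 1 * (ξ 0 - η' 0)) / ‖ξ‖ ^ 2) := by
  rw [contr_eq]
  simp only [Fin.sum_univ_three, polP, polQ, Fin.isValue, Matrix.cons_val_zero, Matrix.cons_val_one,
    Matrix.cons_val, PiLp.sub_apply]
  ring

/-- A lower bound for the heat factor: `e^{-c‖ζ‖²τ} ≥ e^{-c B² τ}` for `‖ζ‖ ≤ B`, `τ, c ≥ 0`. [folklore] -/
theorem heat_ge_of_norm_le {c : ℝ} (hc : 0 ≤ c) {ζ : E3} {B τ : ℝ} (hB : ‖ζ‖ ≤ B) (hτ : 0 ≤ τ) :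
    Real.exp (-(c * B ^ 2) * τ) ≤ heat c ζ τ := by
  rw [heat]
  refine Real.exp_le_exp.2 ?_
  have : ‖ζ‖ ^ 2 ≤ B ^ 2 := pow_le_pow_left₀ (norm_nonneg _) hB 2
  have hcτ : 0 ≤ c * τ := mul_nonneg hc hτ
  nlinarith

/-- **The combo-A kernel is negative and large**: for `ρ ≤ 1/100`, `‖ξ − η‖ < 2ρ` and all `η'`,
`0.96 α² N_s² e^{-8π²(N_s+2)² r⁺} ψ(η' − k_s) ψ(ξ − η' + k'_s) ≤ −pairKer (k_s) (−k'_s) 2 r ξ η'`. [cite: BourgainPavlovic2008, (3.6)–(3.7)] -/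
theorem pairKer_resA_le (hρ : d.ρ ≤ 1 / 100) (s : ℕ) (r : ℝ) {ξ : E3} (hξ : ‖ξ - η‖ < 2 * d.ρ)
    (η' : E3) :
    0.96 * d.α ^ 2 * d.N s ^ 2 * Real.exp (-(2 * (4 * π ^ 2) * (d.N s + 2) ^ 2) * max r 0) *
        (d.ψ (η' - d.kvec s) * d.ψ (ξ - η' + d.kvec' s)) ≤
      -d.pairKer (s, false, false) (s, true, true) 2 r ξ η' := by
  have hρ0 := d.ρ_pos.le
  have hN := d.eight_le_N s
  have hα := d.α_pos.le
  have hca : d.center (s, false, false) = d.kvec s := (d.center_cases s).1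
  have hcb : d.center (s, true, true) = -d.kvec' s := (d.center_cases s).2.2.2
  rw [pairKer, contr_pieceR, hca, hcb]
  simp only [pol_false, pol_true, sub_neg_eq_add]
  by_cases hψ : d.ψ (η' - d.kvec s) = 0
  · rw [hψ]; simp
  -- on the support of the first bump
  have hsupp : ‖η' - d.kvec s‖ < d.ρ := d.norm_lt_of_ψ_ne_zero hψ
  obtain ⟨hy0, hy1, hy2⟩ := d.coords_near_kvec hsupp
  obtain ⟨hx0, hx1, hx2, hnlo, hnhi⟩ := d.coords_near_η hξ
  have hkey := SignalScalar.comboA_contr (n := ‖ξ‖) hN hρ0 hρ hx0 hx1 hx2 hy0 hy1 hy2 hnlo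
  rw [← contr_polP_polQ] at hkey
  -- heat factors
  have hr0 : 0 ≤ max r 0 := le_max_right _ _
  have hη'norm : ‖η'‖ ≤ d.N s + 2 := by
    have := (d.norm_bounds_of_norm_sub_center_lt (a := (s, false, false)) (by rwa [hca])).2
    exact this.le
  have hζnorm : ‖ξ - η'‖ ≤ d.N s + 2 := by
    have h1 : ξ - η' + d.kvec' s = (ξ - η) - (η' - d.kvec s) := by
      rw [kvec']; abel
    have h2 : ‖ξ - η' + d.kvec' s‖ ≤ 3 * d.ρ := by
      rw [h1]
      calc ‖(ξ - η) - (η' - d.kvec s)‖ ≤ ‖ξ - η‖ + ‖η' - d.kvec s‖ := norm_sub_le _ _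
        _ ≤ 3 * d.ρ := by linarith
    have h3 := d.norm_kvec'_le s
    calc ‖ξ - η'‖ = ‖(ξ - η' + d.kvec' s) - d.kvec' s‖ := by congr 1; abel
      _ ≤ ‖ξ - η' + d.kvec' s‖ + ‖d.kvec' s‖ := norm_sub_le _ _
      _ ≤ d.N s + 2 := by linarith
  have hc0 : (0 : ℝ) ≤ 4 * π ^ 2 := by positivity
  have hh1 := heat_ge_of_norm_le hc0 hη'norm hr0
  have hh2 := heat_ge_of_norm_le hc0 hζnorm hr0
  have hexp : Real.exp (-(2 * (4 * π ^ 2) * (d.N s + 2) ^ 2) * max r 0) ≤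
      heat (4 * π ^ 2) η' (max r 0) * heat (4 * π ^ 2) (ξ - η') (max r 0) := by
    have : Real.exp (-(2 * (4 * π ^ 2) * (d.N s + 2) ^ 2) * max r 0) =
        Real.exp (-(4 * π ^ 2 * (d.N s + 2) ^ 2) * max r 0) *
          Real.exp (-(4 * π ^ 2 * (d.N s + 2) ^ 2) * max r 0) := by
      rw [← Real.exp_add]; congr 1; ring
    rw [this]
    exact mul_le_mul hh1 hh2 (Real.exp_pos _).le (heat_nonneg _ _ _)
  have hψψ : 0 ≤ d.ψ (η' - d.kvec s) * d.ψ (ξ - η' + d.kvec' s) :=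
    mul_nonneg (d.ψ_nonneg _) (d.ψ_nonneg _)
  -- assemble
  have hneg : 0 ≤ -contr 2 ξ (polP η') (polQ (ξ - η')) := le_trans (by positivity) hkey
  calc 0.96 * d.α ^ 2 * d.N s ^ 2 * Real.exp (-(2 * (4 * π ^ 2) * (d.N s + 2) ^ 2) * max r 0) *
        (d.ψ (η' - d.kvec s) * d.ψ (ξ - η' + d.kvec' s))
      = Real.exp (-(2 * (4 * π ^ 2) * (d.N s + 2) ^ 2) * max r 0) *
          (d.α ^ 2 * (d.ψ (η' - d.kvec s) * d.ψ (ξ - η' + d.kvec' s)) * (0.96 * d.N s ^ 2)) := by ring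
    _ ≤ (heat (4 * π ^ 2) η' (max r 0) * heat (4 * π ^ 2) (ξ - η') (max r 0)) *
          (d.α ^ 2 * (d.ψ (η' - d.kvec s) * d.ψ (ξ - η' + d.kvec' s)) *
            (-contr 2 ξ (polP η') (polQ (ξ - η')))) := by
        apply mul_le_mul hexp _ (by positivity) (mul_nonneg (heat_nonneg _ _ _) (heat_nonneg _ _ _))
        exact mul_le_mul_of_nonneg_left hkey (by positivity)
    _ = _ := by ring

/-- **The combo-B kernel is small**: for `ρ ≤ 1/100`, `‖ξ − η‖ < 2ρ` and all `η'`,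
`|pairKer (−k'_s) (k_s) 2 r ξ η'| ≤ 0.0005 α² N_s² e^{-4π² N_s² r⁺} ψ(η' + k'_s) ψ(ξ − η' − k_s)`. [cite: BourgainPavlovic2008, (3.6)–(3.7)] -/
theorem abs_pairKer_resB_le (hρ : d.ρ ≤ 1 / 100) (s : ℕ) (r : ℝ) {ξ : E3} (hξ : ‖ξ - η‖ < 2 * d.ρ)
    (η' : E3) :
    |d.pairKer (s, true, true) (s, false, false) 2 r ξ η'| ≤
      0.0005 * d.α ^ 2 * d.N s ^ 2 * Real.exp (-(4 * π ^ 2 * d.N s ^ 2) * max r 0) *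
        (d.ψ (η' + d.kvec' s) * d.ψ (ξ - η' - d.kvec s)) := by
  have hρ0 := d.ρ_pos.le
  have hN := d.eight_le_N s
  have hα := d.α_pos.le
  have hca : d.center (s, true, true) = -d.kvec' s := (d.center_cases s).2.2.2
  have hcb : d.center (s, false, false) = d.kvec s := (d.center_cases s).1
  rw [pairKer, contr_pieceR, hca, hcb]
  simp only [pol_false, pol_true, sub_neg_eq_add]
  by_cases hψa : d.ψ (η' + d.kvec' s) = 0
  · rw [hψa]; simp
  by_cases hψb : d.ψ (ξ - η' - d.kvec s) = 0
  · rw [hψb]; simp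
  have hsa : ‖η' - (-d.kvec' s)‖ < d.ρ := d.norm_lt_of_ψ_ne_zero (by rwa [sub_neg_eq_add])
  have hsb : ‖ξ - η' - d.kvec s‖ < d.ρ := d.norm_lt_of_ψ_ne_zero hψb
  obtain ⟨hy0, hy1, hy2⟩ := d.coords_near_neg_kvec' hsa
  obtain ⟨hx0, hx1, hx2, hnlo, hnhi⟩ := d.coords_near_η hξ
  have hkey := SignalScalar.comboB_contr (n := ‖ξ‖) hN hρ0 hρ hx0 hx1 hx2 hy0 hy1 hy2 hnlo
  rw [← contr_polQ_polP] at hkey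
  have hr0 : 0 ≤ max r 0 := le_max_right _ _
  have hh1 : heat (4 * π ^ 2) η' (max r 0) ≤ Real.exp (-(2 * π ^ 2 * d.N s ^ 2) * max r 0) :=
    d.heat_le_of_norm_sub_center_lt (a := (s, true, true)) hr0 (by rwa [hca])
  have hh2 : heat (4 * π ^ 2) (ξ - η') (max r 0) ≤ Real.exp (-(2 * π ^ 2 * d.N s ^ 2) * max r 0) :=
    d.heat_le_of_norm_sub_center_lt (a := (s, false, false)) hr0 (by rwa [hcb])
  have hexp : heat (4 * π ^ 2) η' (max r 0) * heat (4 * π ^ 2) (ξ - η') (max r 0) ≤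
      Real.exp (-(4 * π ^ 2 * d.N s ^ 2) * max r 0) := by
    have : Real.exp (-(4 * π ^ 2 * d.N s ^ 2) * max r 0) =
        Real.exp (-(2 * π ^ 2 * d.N s ^ 2) * max r 0) * Real.exp (-(2 * π ^ 2 * d.N s ^ 2) * max r 0) := by
      rw [← Real.exp_add]; congr 1; ring
    rw [this]
    exact mul_le_mul hh1 hh2 (heat_nonneg _ _ _) (Real.exp_pos _).le
  have hψψ : 0 ≤ d.ψ (η' + d.kvec' s) * d.ψ (ξ - η' - d.kvec s) :=
    mul_nonneg (d.ψ_nonneg _) (d.ψ_nonneg _)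
  have hP : 0 ≤ heat (4 * π ^ 2) η' (max r 0) * heat (4 * π ^ 2) (ξ - η') (max r 0) *
      (d.α ^ 2 * (d.ψ (η' + d.kvec' s) * d.ψ (ξ - η' - d.kvec s))) :=
    mul_nonneg (mul_nonneg (heat_nonneg _ _ _) (heat_nonneg _ _ _)) (by positivity)
  rw [show heat (4 * π ^ 2) η' (max r 0) * heat (4 * π ^ 2) (ξ - η') (max r 0) *
      (d.α ^ 2 * (d.ψ (η' + d.kvec' s) * d.ψ (ξ - η' - d.kvec s)) * contr 2 ξ (polQ η') (polP (ξ - η'))) =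
      (heat (4 * π ^ 2) η' (max r 0) * heat (4 * π ^ 2) (ξ - η') (max r 0) *
        (d.α ^ 2 * (d.ψ (η' + d.kvec' s) * d.ψ (ξ - η' - d.kvec s)))) * contr 2 ξ (polQ η') (polP (ξ - η'))
    by ring, abs_mul, abs_of_nonneg hP]
  calc heat (4 * π ^ 2) η' (max r 0) * heat (4 * π ^ 2) (ξ - η') (max r 0) *
        (d.α ^ 2 * (d.ψ (η' + d.kvec' s) * d.ψ (ξ - η' - d.kvec s))) *
          |contr 2 ξ (polQ η') (polP (ξ - η'))|
      ≤ Real.exp (-(4 * π ^ 2 * d.N s ^ 2) * max r 0) *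
        (d.α ^ 2 * (d.ψ (η' + d.kvec' s) * d.ψ (ξ - η' - d.kvec s))) * (0.0005 * d.N s ^ 2) := by
        apply mul_le_mul _ hkey (abs_nonneg _) (by positivity)
        exact mul_le_mul_of_nonneg_right hexp (by positivity)
    _ = _ := by ring

/-- **The combo-A frequency integral**:
`0.96 α² N_s² e^{-8π²(N_s+2)² r⁺} (ψ⋆ψ)(ξ − η) ≤ −pairG (k_s) (−k'_s) 2 r ξ`. [cite: BourgainPavlovic2008, (3.7)] -/
theorem pairG_resA_le (hρ : d.ρ ≤ 1 / 100) (s : ℕ) (r : ℝ) {ξ : E3} (hξ : ‖ξ - η‖ < 2 * d.ρ) :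
    0.96 * d.α ^ 2 * d.N s ^ 2 * Real.exp (-(2 * (4 * π ^ 2) * (d.N s + 2) ^ 2) * max r 0) *
        d.bumpConv (ξ - η) ≤ -d.pairG (s, false, false) (s, true, true) 2 r ξ := by
  rw [pairG, ← MeasureTheory.integral_neg]
  have hshift : ∫ t, d.ψ (t - d.kvec s) * d.ψ (ξ - t + d.kvec' s) = d.bumpConv (ξ - η) := by
    have h := d.integral_bumpShift (d.kvec s) (-d.kvec' s) ξ
    simp only [sub_neg_eq_add] at h
    rw [h]; congr 1; rw [kvec']; abel
  rw [← hshift, ← MeasureTheory.integral_const_mul]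
  refine integral_mono ?_ (d.integrable_pairKer _ _ 2 r ξ).neg fun η' => d.pairKer_resA_le hρ s r hξ η'
  have hi := d.integrable_bumpShift (d.kvec s) (-d.kvec' s) ξ
  simp only [sub_neg_eq_add] at hi
  exact hi.const_mul _

/-- **The combo-B frequency integral**:
`|pairG (−k'_s) (k_s) 2 r ξ| ≤ 0.0005 α² N_s² e^{-4π² N_s² r⁺} (ψ⋆ψ)(ξ − η)`. [cite: BourgainPavlovic2008, (3.7)] -/
theorem abs_pairG_resB_le (hρ : d.ρ ≤ 1 / 100) (s : ℕ) (r : ℝ) {ξ : E3} (hξ : ‖ξ - η‖ < 2 * d.ρ) :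
    |d.pairG (s, true, true) (s, false, false) 2 r ξ| ≤
      0.0005 * d.α ^ 2 * d.N s ^ 2 * Real.exp (-(4 * π ^ 2 * d.N s ^ 2) * max r 0) * d.bumpConv (ξ - η) := by
  rw [pairG]
  have hshift : ∫ t, d.ψ (t + d.kvec' s) * d.ψ (ξ - t - d.kvec s) = d.bumpConv (ξ - η) := by
    have h := d.integral_bumpShift (-d.kvec' s) (d.kvec s) ξ
    simp only [sub_neg_eq_add] at h
    rw [h]; congr 1; rw [kvec']; abel
  rw [← hshift, ← MeasureTheory.integral_const_mul, ← Real.norm_eq_abs]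
  refine norm_integral_le_of_norm_le ?_ (Eventually.of_forall fun η' => ?_)
  · have hi := d.integrable_bumpShift (-d.kvec' s) (d.kvec s) ξ
    simp only [sub_neg_eq_add] at hi
    exact hi.const_mul _
  · rw [Real.norm_eq_abs]
    exact d.abs_pairKer_resB_le hρ s r hξ η'

/-! ### The time integrals -/

set_option maxHeartbeats 400000 in
/-- **The resonant pair of type A feeds the low mode**: for `ρ ≤ 1/100`, `0 < T ≤ 1/400`,
`8π² N_0² T ≥ 1` and `‖ξ − η‖ < 2ρ`,
`0.17 α² (ψ⋆ψ)(ξ−η)/(4π²) ≤ −pairGT (k_s) (−k'_s) 2 T ξ` (Bourgain–Pavlović's (3.8):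
`N_s² ∫₀ᵀ e^{-c N_s² τ} dτ ∼ 1`). [cite: BourgainPavlovic2008, (3.8)] -/
theorem pairGT_resA_le (hρ : d.ρ ≤ 1 / 100) {T : ℝ} (hT0 : 0 < T) (hT : T ≤ 1 / 400)
    (hNT : 1 ≤ 8 * π ^ 2 * d.N 0 ^ 2 * T) (s : ℕ) {ξ : E3} (hξ : ‖ξ - η‖ < 2 * d.ρ) :
    0.17 * d.α ^ 2 * d.bumpConv (ξ - η) / (4 * π ^ 2) ≤
      -d.pairGT (s, false, false) (s, true, true) 2 T ξ := by
  have hρ0 := d.ρ_pos.le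
  have hN := d.eight_le_N s
  have hN0 : d.N 0 ≤ d.N s := d.N_mono (Nat.zero_le s)
  have hα := d.α_pos.le
  have hB := d.bumpConv_nonneg (ξ - η)
  obtain ⟨hx0, hx1, hx2, hnlo, hnhi⟩ := d.coords_near_η hξ
  set c : ℝ := 4 * π ^ 2 with hc
  have hc0 : 0 < c := by positivity
  set κ : ℝ := 2 * c * (d.N s + 2) ^ 2 with hκ
  have hκ0 : 0 < κ := by positivity
  set L : ℝ := 0.96 * d.α ^ 2 * d.N s ^ 2 * d.bumpConv (ξ - η) with hL
  have hL0 : 0 ≤ L := by positivity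
  set θ : ℝ := Real.exp (-(1.05 * c * T)) with hθ
  have hθ0 : 0 < θ := Real.exp_pos _
  -- pointwise lower bound of the integrand on `[0, T]`
  have hpt : ∀ r ∈ Icc 0 T, θ * L * Real.exp (-κ * r) ≤
      heat c ξ (T - r) * (-d.pairG (s, false, false) (s, true, true) 2 r ξ) := by
    intro r hr
    have hr0 : max r 0 = r := max_eq_left hr.1
    have h1 := d.pairG_resA_le hρ s r hξ
    rw [hr0] at h1
    have h1' : L * Real.exp (-κ * r) ≤ -d.pairG (s, false, false) (s, true, true) 2 r ξ := by
      calc L * Real.exp (-κ * r) = 0.96 * d.α ^ 2 * d.N s ^ 2 *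
            Real.exp (-(2 * (4 * π ^ 2) * (d.N s + 2) ^ 2) * r) * d.bumpConv (ξ - η) := by
            rw [hL, hκ, hc]; ring
        _ ≤ _ := h1
    have h2 : θ ≤ heat c ξ (T - r) := by
      rw [hθ, heat]
      refine Real.exp_le_exp.2 ?_
      have hξ2 : ‖ξ‖ ^ 2 ≤ 1.05 := by nlinarith [norm_nonneg ξ]
      have hTr : 0 ≤ T - r := by linarith [hr.2]
      have hTr' : T - r ≤ T := by linarith [hr.1]
      have k1 : c * ‖ξ‖ ^ 2 * (T - r) ≤ c * 1.05 * (T - r) := by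
        apply mul_le_mul_of_nonneg_right _ hTr
        exact mul_le_mul_of_nonneg_left hξ2 hc0.le
      have k2 : c * 1.05 * (T - r) ≤ c * 1.05 * T := mul_le_mul_of_nonneg_left hTr' (by positivity)
      linarith
    calc θ * L * Real.exp (-κ * r) = θ * (L * Real.exp (-κ * r)) := by ring
      _ ≤ heat c ξ (T - r) * (-d.pairG (s, false, false) (s, true, true) 2 r ξ) :=
          mul_le_mul h2 h1' (by positivity) (heat_nonneg _ _ _)
  -- integrate
  have hcont : Continuous fun r => heat c ξ (T - r) * (-d.pairG (s, false, false) (s, true, true) 2 r ξ) :=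
    (continuous_heat_comp c continuous_const (continuous_const.sub continuous_id)).mul
      (d.continuous_pairG _ _ 2 ξ).neg
  have hint := intervalIntegral.integral_mono_on (μ := volume) hT0.le
    ((by fun_prop : Continuous fun r => θ * L * Real.exp (-κ * r)).intervalIntegrable _ _)
    (hcont.intervalIntegrable _ _) hpt
  rw [intervalIntegral.integral_const_mul] at hint
  have hκT : 1 ≤ κ * T := by
    rw [hκ, hc]
    have h1 : d.N 0 ^ 2 ≤ (d.N s + 2) ^ 2 := by nlinarith [d.N_pos 0]
    have h2 : 0 ≤ 2 * (4 * π ^ 2) * T := by positivity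
    have h3 : 8 * π ^ 2 * d.N 0 ^ 2 * T = (2 * (4 * π ^ 2) * T) * d.N 0 ^ 2 := by ring
    have h4 : 2 * (4 * π ^ 2) * (d.N s + 2) ^ 2 * T = (2 * (4 * π ^ 2) * T) * (d.N s + 2) ^ 2 := by ring
    rw [h4]
    rw [h3] at hNT
    exact hNT.trans (mul_le_mul_of_nonneg_left h1 h2)
  have hI := SignalScalar.integral_exp_neg_ge (T := T) hκ0 hκT
  have hθ89 : 0.89 ≤ θ := by rw [hθ, hc]; exact SignalScalar.exp_neg_ge_089 hT hT0.le
  -- the value of `−pairGT`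
  have hval : -d.pairGT (s, false, false) (s, true, true) 2 T ξ =
      ∫ r in (0 : ℝ)..T, heat c ξ (T - r) * (-d.pairG (s, false, false) (s, true, true) 2 r ξ) := by
    rw [pairGT, ← intervalIntegral.integral_neg]
    congr 1; funext r; rw [hc]; ring
  rw [hval]
  refine le_trans ?_ hint
  have step1 : θ * L * (0.632 / κ) ≤ θ * L * ∫ r in (0 : ℝ)..T, Real.exp (-κ * r) :=
    mul_le_mul_of_nonneg_left hI (by positivity)
  refine le_trans ?_ step1
  -- `0.17 α² B / c ≤ θ L (0.632/κ)`: clear the two denominators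
  have hR : θ * L * (0.632 / κ) = (θ * L * 0.632) / κ := by ring
  rw [hR, div_le_div_iff₀ hc0 hκ0, hL, hκ]
  -- goal: `0.17 α² B (2c(N+2)²) ≤ θ (0.96 α² N² B) 0.632 c`
  set X : ℝ := c * (d.α ^ 2 * d.bumpConv (ξ - η)) with hX
  have hX0 : 0 ≤ X := by positivity
  have hsq : (d.N s + 2) ^ 2 ≤ 1.5625 * d.N s ^ 2 := by nlinarith
  have k1 : 0.17 * d.α ^ 2 * d.bumpConv (ξ - η) * (2 * c * (d.N s + 2) ^ 2) = 0.34 * X * (d.N s + 2) ^ 2 := by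
    rw [hX]; ring
  have k2 : θ * (0.96 * d.α ^ 2 * d.N s ^ 2 * d.bumpConv (ξ - η)) * 0.632 * c =
      (0.60672 * θ) * (X * d.N s ^ 2) := by rw [hX]; ring
  rw [k1, k2]
  have k3 : 0.34 * X * (d.N s + 2) ^ 2 ≤ 0.34 * X * (1.5625 * d.N s ^ 2) :=
    mul_le_mul_of_nonneg_left hsq (by positivity)
  have k4 : (0.34 * 1.5625 : ℝ) ≤ 0.60672 * θ := by nlinarith
  have k5 : 0.34 * X * (1.5625 * d.N s ^ 2) = (0.34 * 1.5625) * (X * d.N s ^ 2) := by ring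
  have k6 : (0.34 * 1.5625) * (X * d.N s ^ 2) ≤ (0.60672 * θ) * (X * d.N s ^ 2) :=
    mul_le_mul_of_nonneg_right k4 (by positivity)
  linarith

/-- **The resonant pair of type B is negligible**:
`|pairGT (−k'_s) (k_s) 2 T ξ| ≤ 0.0005 α² (ψ⋆ψ)(ξ−η)/(4π²)` (`T ≥ 0`). [cite: BourgainPavlovic2008, (3.8)] -/
theorem abs_pairGT_resB_le (hρ : d.ρ ≤ 1 / 100) {T : ℝ} (hT0 : 0 ≤ T) (s : ℕ) {ξ : E3}
    (hξ : ‖ξ - η‖ < 2 * d.ρ) :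
    |d.pairGT (s, true, true) (s, false, false) 2 T ξ| ≤
      0.0005 * d.α ^ 2 * d.bumpConv (ξ - η) / (4 * π ^ 2) := by
  have hN := d.eight_le_N s
  have hNpos := d.N_pos s
  have hα := d.α_pos.le
  have hB := d.bumpConv_nonneg (ξ - η)
  set c : ℝ := 4 * π ^ 2 with hc
  have hc0 : 0 < c := by positivity
  set κ : ℝ := c * d.N s ^ 2 with hκ
  have hκ0 : 0 < κ := by positivity
  set L : ℝ := 0.0005 * d.α ^ 2 * d.N s ^ 2 * d.bumpConv (ξ - η) with hL
  have hL0 : 0 ≤ L := by positivity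
  have hpt : ∀ r ∈ Icc 0 T, |heat c ξ (T - r) * d.pairG (s, true, true) (s, false, false) 2 r ξ| ≤
      L * Real.exp (-κ * r) := by
    intro r hr
    have hr0 : max r 0 = r := max_eq_left hr.1
    have h1 := d.abs_pairG_resB_le hρ s r hξ
    rw [hr0] at h1
    rw [abs_mul, abs_of_nonneg (heat_nonneg _ _ _)]
    calc heat c ξ (T - r) * |d.pairG (s, true, true) (s, false, false) 2 r ξ|
        ≤ 1 * (L * Real.exp (-κ * r)) := by
          apply mul_le_mul (heat_le_one hc0.le (by linarith [hr.2]) ξ) _ (abs_nonneg _) zero_le_one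
          calc |d.pairG (s, true, true) (s, false, false) 2 r ξ| ≤ _ := h1
            _ = L * Real.exp (-κ * r) := by rw [hL, hκ, hc]; ring
      _ = L * Real.exp (-κ * r) := one_mul _
  have hcont : Continuous fun r => heat c ξ (T - r) * d.pairG (s, true, true) (s, false, false) 2 r ξ :=
    (continuous_heat_comp c continuous_const (continuous_const.sub continuous_id)).mul
      (d.continuous_pairG _ _ 2 ξ)
  rw [pairGT]
  calc |∫ r in (0 : ℝ)..T, heat (4 * π ^ 2) ξ (T - r) * d.pairG (s, true, true) (s, false, false) 2 r ξ|
      ≤ ∫ r in (0 : ℝ)..T, |heat c ξ (T - r) * d.pairG (s, true, true) (s, false, false) 2 r ξ| := by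
        rw [← hc]; exact intervalIntegral.abs_integral_le_integral_abs hT0
    _ ≤ ∫ r in (0 : ℝ)..T, L * Real.exp (-κ * r) :=
        intervalIntegral.integral_mono_on (μ := volume) hT0 (hcont.abs.intervalIntegrable _ _)
          ((by fun_prop : Continuous fun r => L * Real.exp (-κ * r)).intervalIntegrable _ _) hpt
    _ = L * ∫ r in (0 : ℝ)..T, Real.exp (-κ * r) := intervalIntegral.integral_const_mul _ _
    _ ≤ L * (1 / κ) := mul_le_mul_of_nonneg_left (SignalScalar.integral_exp_neg_le hκ0 T) hL0
    _ = 0.0005 * d.α ^ 2 * d.bumpConv (ξ - η) / (4 * π ^ 2) := by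
        rw [hL, hκ, hc]; field_simp

/-- **Per-scale signal**: `α² (ψ⋆ψ)(ξ−η)/250 ≤ −(pairGT (k_s)(−k'_s) + pairGT (−k'_s)(k_s))`. [cite: BourgainPavlovic2008, (3.8)] -/
theorem signal_scale (hρ : d.ρ ≤ 1 / 100) {T : ℝ} (hT0 : 0 < T) (hT : T ≤ 1 / 400)
    (hNT : 1 ≤ 8 * π ^ 2 * d.N 0 ^ 2 * T) (s : ℕ) {ξ : E3} (hξ : ‖ξ - η‖ < 2 * d.ρ) :
    d.α ^ 2 * d.bumpConv (ξ - η) / 250 ≤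
      -(d.pairGT (s, false, false) (s, true, true) 2 T ξ + d.pairGT (s, true, true) (s, false, false) 2 T ξ) := by
  have hA := d.pairGT_resA_le hρ hT0 hT hNT s hξ
  have hB := d.abs_pairGT_resB_le hρ hT0.le s hξ
  have hB' := (abs_le.1 hB).2
  have hX : 0 ≤ d.α ^ 2 * d.bumpConv (ξ - η) := mul_nonneg (sq_nonneg _) (d.bumpConv_nonneg _)
  have hc := SignalScalar.four_pi_sq_le
  have hc0 : 0 < 4 * π ^ 2 := by positivity
  have hkey : d.α ^ 2 * d.bumpConv (ξ - η) / 250 ≤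
      0.17 * d.α ^ 2 * d.bumpConv (ξ - η) / (4 * π ^ 2) - 0.0005 * d.α ^ 2 * d.bumpConv (ξ - η) / (4 * π ^ 2) := by
    rw [← sub_div, div_le_div_iff₀ (by norm_num) hc0]
    nlinarith
  linarith

/-- **The inflating low mode.** For `ρ ≤ 1/100`, `0 < T ≤ 1/400`, `8π² N_0² T ≥ 1` and
`‖ξ − η‖ < 2ρ`: `Re u₁(T,ξ)₂ = 0` and
`α² r (ψ⋆ψ)(ξ − η)/250 ≤ −Im u₁(T,ξ)₂/(2π)`, i.e. `−u₁(T, ξ)₂ = 2πi 𝓡(ξ)` with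
`𝓡(ξ) ≥ Q² (ψ⋆ψ)(ξ−η)/250 ≥ 0` (`Q² = α² r`): the sum of the `r` resonant interactions, each of
unit size after the time integration, Bourgain–Pavlović's (3.22)–(3.24). [cite: BourgainPavlovic2008, (3.8), (3.22)–(3.24)] -/
theorem signal_lower_bound (hρ : d.ρ ≤ 1 / 100) {T : ℝ} (hT0 : 0 < T) (hT : T ≤ 1 / 400)
    (hNT : 1 ≤ 8 * π ^ 2 * d.N 0 ^ 2 * T) {ξ : E3} (hξ : ‖ξ - η‖ < 2 * d.ρ) :
    (d.secondIterate T ξ 2).re = 0 ∧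
      d.α ^ 2 * d.r * d.bumpConv (ξ - η) / 250 ≤ -(d.secondIterate T ξ 2).im / (2 * π) := by
  refine ⟨d.secondIterate_re T ξ 2, ?_⟩
  rw [d.secondIterate_im_of_near_η 2 T hξ]
  have hπ : 0 < 2 * π := by positivity
  rw [show -(2 * π * ∑ s ∈ Finset.range d.r, (d.pairGT (s, false, false) (s, true, true) 2 T ξ +
      d.pairGT (s, true, true) (s, false, false) 2 T ξ)) / (2 * π) =
      ∑ s ∈ Finset.range d.r, -(d.pairGT (s, false, false) (s, true, true) 2 T ξ +
        d.pairGT (s, true, true) (s, false, false) 2 T ξ) by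
    rw [Finset.sum_neg_distrib]; field_simp]
  calc d.α ^ 2 * d.r * d.bumpConv (ξ - η) / 250
      = ∑ _s ∈ Finset.range d.r, d.α ^ 2 * d.bumpConv (ξ - η) / 250 := by
        rw [Finset.sum_const, Finset.card_range, nsmul_eq_mul]; ring
    _ ≤ _ := Finset.sum_le_sum fun s _ => d.signal_scale hρ hT0 hT hNT s hξ

end InflationParams

end Literature.Analysis.FluidPDE.BourgainPavlovic
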